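import Summits.Ventures.HodgeRepro2.T5SU11IwasawaHaar

/-!
# The left Haar measure and the modular function of the Borel subgroup `B = A N`

In the chart `ζ = s + i t ↦ a_t n_s` of the Borel subgroup `B = A N` of `T5SU11BorelSubgroup`
(`borelCoord`, a bijection `ℂ → B`), left translation by `a_τ n_σ` is the shear
`(s, t) ↦ (s + e^{-2t} σ, t + τ)` (`leftShear`, Jacobian `1`) and right translation by `a_τ n_σ`
is the affine map `(s, t) ↦ (e^{-2τ} s + σ, t + τ)` (`rightAffine`, Jacobian `e^{-2τ}`)
(`hyp_mul_unip_mul_borelCoord`, `borelCoord_mul_hyp_mul_unip`). Hence the Lebesgue measure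
`ds dt` of the chart is invariant under every left translation (`map_leftShear_volume`) while a
right translation by `a_τ n_σ` multiplies it by `e^{2τ}` (`map_rightAffine_volume`): transported to
`B`, `borelHaar := (borelCoord)_* (ds dt)` is a LEFT-invariant measure on `B`
(`isMulLeftInvariant_borelHaar`) with `(· b)_* borelHaar = e^{2τ} borelHaar` for `b = a_τ n_σ`
(`map_mul_right_borelHaar`) — the modular function `Δ_B(a_τ n_σ) = e^{2τ}`; `B` is not unimodular
(`not_isMulRightInvariant_borelHaar`). Nothing is claimed about (N).

Blind lane: Mathlib + the HodgeRepro2 prefix only; no sorry; axioms ⊆ {propext, Classical.choice,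
Quot.sound}.
-/

namespace Summit.Ventures.HodgeRepro2.T5SU11BorelHaar

open MeasureTheory MeasureTheory.Measure Metric Filter Topology Set Complex
open T5UnitaryBound T5PoincareDensity T5PoincareInvariance T5PoincareMeasure T5SU11Unimodular
  T5SU11Fibration T5SU11FibrationHaar T5SU11Cartan T5SU11OneParameter T5BergmanCoefficient
  T5SU11HyperbolicSubgroup T5SU11UnipotentSubgroup T5SU11BorelSubgroup T5SU11Iwasawa
  T5SU11IwasawaUnique T5SU11BorelTransitive T5SU11IwasawaHaar
open scoped ENNReal NNReal

/-! ### The chart `ζ = s + i t ↦ a_t n_s` of `B` and the translations in the chart -/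

/-- The chart of the Borel subgroup: `ζ = s + i t ↦ a_t n_s`. -/
noncomputable def borelCoord (ζ : ℂ) : SU11 := hyp ζ.im * unip ζ.re

/-- Left translation by `a_τ n_σ` in the chart: `(s, t) ↦ (s + e^{-2t} σ, t + τ)`. -/
noncomputable def leftShear (τ σ : ℝ) (ζ : ℂ) : ℂ :=
  ⟨ζ.re + Real.exp (-(2 * ζ.im)) * σ, ζ.im + τ⟩

/-- Right translation by `a_τ n_σ` in the chart: `(s, t) ↦ (e^{-2τ} s + σ, t + τ)`. -/
noncomputable def rightAffine (τ σ : ℝ) (ζ : ℂ) : ℂ :=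
  ⟨Real.exp (-(2 * τ)) * ζ.re + σ, ζ.im + τ⟩

/-- `a_t n_s ∈ B`. -/
lemma borelCoord_mem (ζ : ℂ) : borelCoord ζ ∈ borelSubgroup := hyp_mul_unip_mem_borelSubgroup _ _

/-- The chart is injective (`B` acts simply transitively on the disc, `T5SU11BorelTransitive`). -/
theorem borelCoord_injective : Function.Injective borelCoord := by
  intro ζ ζ' h
  have h1 : orbit (unip (Real.exp (2 * ζ.im) * ζ.re) * hyp ζ.im) =
      orbit (unip (Real.exp (2 * ζ'.im) * ζ'.re) * hyp ζ'.im) := by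
    unfold borelCoord at h
    rw [hyp_mul_unip, hyp_mul_unip] at h
    rw [h]
  obtain ⟨hs, ht⟩ := orbit_unip_mul_hyp_injective h1
  rw [ht] at hs
  have hE : Real.exp (2 * ζ'.im) ≠ 0 := (Real.exp_pos _).ne'
  exact Complex.ext (mul_left_cancel₀ hE hs) ht

/-- The chart is onto `B`. -/
theorem borelCoord_surjOn : ∀ g ∈ borelSubgroup, ∃ ζ : ℂ, borelCoord ζ = g := by
  rintro g ⟨t, s, rfl⟩
  exact ⟨⟨s, t⟩, rfl⟩

/-- **Left translation in the chart**: `a_τ n_σ · a_t n_s = a_{t+τ} n_{s + e^{-2t} σ}`. -/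
theorem hyp_mul_unip_mul_borelCoord (τ σ : ℝ) (ζ : ℂ) :
    hyp τ * unip σ * borelCoord ζ = borelCoord (leftShear τ σ ζ) := by
  unfold borelCoord leftShear
  simp only
  rw [mul_assoc, ← mul_assoc (unip σ), unip_mul_hyp σ ζ.im, mul_assoc, ← unip_add, ← mul_assoc,
    ← hyp_add, add_comm ζ.im τ, add_comm ζ.re]

/-- **Right translation in the chart**: `a_t n_s · a_τ n_σ = a_{t+τ} n_{e^{-2τ} s + σ}`. -/
theorem borelCoord_mul_hyp_mul_unip (τ σ : ℝ) (ζ : ℂ) :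
    borelCoord ζ * (hyp τ * unip σ) = borelCoord (rightAffine τ σ ζ) := by
  unfold borelCoord rightAffine
  simp only
  rw [mul_assoc, ← mul_assoc (unip ζ.re), unip_mul_hyp ζ.re τ, mul_assoc, ← unip_add, ← mul_assoc,
    ← hyp_add]

/-! ### The Jacobians of the translations -/

/-- `leftShear` as a formula: `ζ ↦ ζ + (e^{-2 Im ζ} σ + τ i)`. -/
lemma leftShear_eq (τ σ : ℝ) (ζ : ℂ) :
    leftShear τ σ ζ = ζ + (((Real.exp (-(2 * ζ.im)) * σ : ℝ) : ℂ) + (τ : ℂ) * I) := by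
  apply Complex.ext
  · simp only [leftShear, Complex.add_re, Complex.ofReal_re, Complex.mul_re, Complex.ofReal_im,
      Complex.I_re, Complex.I_im]
    ring
  · simp only [leftShear, Complex.add_im, Complex.ofReal_im, Complex.mul_im, Complex.ofReal_re,
      Complex.I_re, Complex.I_im]
    ring

/-- `rightAffine` as a formula: `ζ ↦ (e^{-2τ} Re ζ + σ) + (Im ζ + τ) i`. -/
lemma rightAffine_eq (τ σ : ℝ) (ζ : ℂ) :
    rightAffine τ σ ζ =
      ((Real.exp (-(2 * τ)) * ζ.re + σ : ℝ) : ℂ) + ((ζ.im + τ : ℝ) : ℂ) * I := by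
  apply Complex.ext
  · simp only [rightAffine, Complex.add_re, Complex.ofReal_re, Complex.mul_re, Complex.ofReal_im,
      Complex.I_re, Complex.I_im]
    ring
  · simp only [rightAffine, Complex.add_im, Complex.ofReal_im, Complex.mul_im, Complex.ofReal_re,
      Complex.I_re, Complex.I_im]
    ring

/-- The real derivative of `leftShear τ σ` at `ζ`: `η ↦ η - 2 σ e^{-2 Im ζ} Im η`. -/
noncomputable def leftShearDeriv (σ : ℝ) (ζ : ℂ) : ℂ →L[ℝ] ℂ :=
  ContinuousLinearMap.id ℝ ℂ +
    Complex.ofRealCLM.comp (σ • (Real.exp (-(2 * ζ.im)) • (-((2 : ℝ) • Complex.imCLM))))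

/-- The real derivative of `rightAffine τ σ` (constant): `η ↦ e^{-2τ} Re η + Im η i`. -/
noncomputable def rightAffineDeriv (τ : ℝ) : ℂ →L[ℝ] ℂ :=
  Complex.ofRealCLM.comp (Real.exp (-(2 * τ)) • Complex.reCLM) + I • Complex.ofRealCLM.comp Complex.imCLM

/-- `leftShearDeriv` applied to `η`. -/
lemma leftShearDeriv_apply (σ : ℝ) (ζ η : ℂ) :
    leftShearDeriv σ ζ η = η + ((σ * (Real.exp (-(2 * ζ.im)) * -(2 * η.im)) : ℝ) : ℂ) := by
  simp only [leftShearDeriv, _root_.add_apply, ContinuousLinearMap.id_apply,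
    ContinuousLinearMap.comp_apply, _root_.smul_apply, _root_.neg_apply,
    Complex.ofRealCLM_apply, Complex.imCLM_apply, smul_eq_mul, smul_neg]
  congr 2
  ring

/-- `rightAffineDeriv` applied to `η`. -/
lemma rightAffineDeriv_apply (τ : ℝ) (η : ℂ) :
    rightAffineDeriv τ η = ((Real.exp (-(2 * τ)) * η.re : ℝ) : ℂ) + I * (η.im : ℂ) := by
  simp only [rightAffineDeriv, _root_.add_apply, ContinuousLinearMap.comp_apply, _root_.smul_apply,
    Complex.ofRealCLM_apply, Complex.reCLM_apply, Complex.imCLM_apply, smul_eq_mul]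

/-- `leftShear τ σ` is real-differentiable with derivative `leftShearDeriv σ ζ`. -/
lemma hasFDerivAt_leftShear (τ σ : ℝ) (ζ : ℂ) :
    HasFDerivAt (leftShear τ σ) (leftShearDeriv σ ζ) ζ := by
  have e : leftShear τ σ = fun ζ => ζ + (((Real.exp (-(2 * ζ.im)) * σ : ℝ) : ℂ) + (τ : ℂ) * I) :=
    funext (leftShear_eq τ σ)
  rw [e]
  have hg : HasFDerivAt (fun ζ : ℂ => -(2 * ζ.im)) (-((2 : ℝ) • Complex.imCLM)) ζ :=
    (Complex.imCLM.hasFDerivAt.const_mul 2).neg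
  have he : HasFDerivAt (fun ζ : ℂ => Real.exp (-(2 * ζ.im)))
      (Real.exp (-(2 * ζ.im)) • (-((2 : ℝ) • Complex.imCLM))) ζ :=
    (Real.hasDerivAt_exp _).comp_hasFDerivAt ζ hg
  have hm : HasFDerivAt (fun ζ : ℂ => Real.exp (-(2 * ζ.im)) * σ)
      (σ • (Real.exp (-(2 * ζ.im)) • (-((2 : ℝ) • Complex.imCLM)))) ζ := he.mul_const σ
  have h1 : HasFDerivAt (fun ζ : ℂ => ((Real.exp (-(2 * ζ.im)) * σ : ℝ) : ℂ))
      (Complex.ofRealCLM.comp (σ • (Real.exp (-(2 * ζ.im)) • (-((2 : ℝ) • Complex.imCLM))))) ζ :=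
    Complex.ofRealCLM.hasFDerivAt.comp ζ hm
  exact (hasFDerivAt_id ζ).add (h1.add_const ((τ : ℂ) * I))

/-- `rightAffine τ σ` is real-differentiable with the constant derivative `rightAffineDeriv τ`. -/
lemma hasFDerivAt_rightAffine (τ σ : ℝ) (ζ : ℂ) :
    HasFDerivAt (rightAffine τ σ) (rightAffineDeriv τ) ζ := by
  have e : rightAffine τ σ =
      fun ζ => ((Real.exp (-(2 * τ)) * ζ.re + σ : ℝ) : ℂ) + ((ζ.im + τ : ℝ) : ℂ) * I :=
    funext (rightAffine_eq τ σ)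
  rw [e]
  have h1 : HasFDerivAt (fun ζ : ℂ => ((Real.exp (-(2 * τ)) * ζ.re + σ : ℝ) : ℂ))
      (Complex.ofRealCLM.comp (Real.exp (-(2 * τ)) • Complex.reCLM)) ζ :=
    Complex.ofRealCLM.hasFDerivAt.comp ζ
      ((Complex.reCLM.hasFDerivAt.const_mul (Real.exp (-(2 * τ)))).add_const σ)
  have h2 : HasFDerivAt (fun ζ : ℂ => ((ζ.im + τ : ℝ) : ℂ) * I)
      (I • Complex.ofRealCLM.comp Complex.imCLM) ζ :=
    (Complex.ofRealCLM.hasFDerivAt.comp ζ (Complex.imCLM.hasFDerivAt.add_const τ)).mul_const I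
  exact h1.add h2

/-- **The Jacobian of a left translation is `1`.** -/
theorem det_leftShearDeriv (σ : ℝ) (ζ : ℂ) : (leftShearDeriv σ ζ).det = 1 := by
  show LinearMap.det ((leftShearDeriv σ ζ : ℂ →L[ℝ] ℂ) : ℂ →ₗ[ℝ] ℂ) = _
  rw [← LinearMap.det_toMatrix Complex.basisOneI, Matrix.det_fin_two]
  simp only [LinearMap.toMatrix_apply, ContinuousLinearMap.coe_coe, Complex.coe_basisOneI,
    Complex.coe_basisOneI_repr, leftShearDeriv_apply, Matrix.cons_val_zero, Matrix.cons_val_one,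
    Complex.one_re, Complex.one_im, Complex.I_re, Complex.I_im, Complex.add_re, Complex.add_im,
    Complex.ofReal_re, Complex.ofReal_im]
  ring

/-- **The Jacobian of a right translation by `a_τ n_σ` is `e^{-2τ}`.** -/
theorem det_rightAffineDeriv (τ : ℝ) : (rightAffineDeriv τ).det = Real.exp (-(2 * τ)) := by
  show LinearMap.det ((rightAffineDeriv τ : ℂ →L[ℝ] ℂ) : ℂ →ₗ[ℝ] ℂ) = _
  rw [← LinearMap.det_toMatrix Complex.basisOneI, Matrix.det_fin_two]
  simp only [LinearMap.toMatrix_apply, ContinuousLinearMap.coe_coe, Complex.coe_basisOneI,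
    Complex.coe_basisOneI_repr, rightAffineDeriv_apply, Matrix.cons_val_zero, Matrix.cons_val_one,
    Complex.one_re, Complex.one_im, Complex.I_re, Complex.I_im, Complex.add_re, Complex.add_im,
    Complex.ofReal_re, Complex.ofReal_im, Complex.mul_re, Complex.mul_im]
  ring

/-! ### The translations are bijections of the chart -/

/-- `leftShear τ σ` is a bijection (inverse `leftShear (-τ) (-e^{2τ} σ)`). -/
theorem leftShear_bijective (τ σ : ℝ) : Function.Bijective (leftShear τ σ) := by
  constructor
  · intro ζ ζ' h
    have h1 := congrArg Complex.im h
    have h2 := congrArg Complex.re h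
    simp only [leftShear] at h1 h2
    have ht : ζ.im = ζ'.im := by linarith
    rw [ht] at h2
    exact Complex.ext (by linarith) ht
  · intro w
    refine ⟨⟨w.re - Real.exp (-(2 * (w.im - τ))) * σ, w.im - τ⟩, ?_⟩
    apply Complex.ext
    · simp only [leftShear]
      ring
    · simp only [leftShear]
      ring

/-- `rightAffine τ σ` is a bijection (inverse `rightAffine (-τ) (-e^{2τ} σ)`). -/
theorem rightAffine_bijective (τ σ : ℝ) : Function.Bijective (rightAffine τ σ) := by
  have hE : Real.exp (-(2 * τ)) ≠ 0 := (Real.exp_pos _).ne'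
  constructor
  · intro ζ ζ' h
    have h1 := congrArg Complex.im h
    have h2 := congrArg Complex.re h
    simp only [rightAffine] at h1 h2
    have hs : ζ.re = ζ'.re := mul_left_cancel₀ hE (by linarith)
    exact Complex.ext hs (by linarith)
  · intro w
    refine ⟨⟨(w.re - σ) / Real.exp (-(2 * τ)), w.im - τ⟩, ?_⟩
    apply Complex.ext
    · simp only [rightAffine]
      field_simp
      ring
    · simp only [rightAffine]
      ring

/-! ### The Lebesgue measure of the chart under the translations -/

/-- **Left translations preserve `ds dt`**: `(leftShear τ σ)_* volume = volume`. -/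
theorem map_leftShear_volume (τ σ : ℝ) :
    Measure.map (leftShear τ σ) (volume : Measure ℂ) = volume := by
  have h := map_withDensity_abs_det_fderiv_eq_addHaar (volume : Measure ℂ)
    MeasurableSet.univ.nullMeasurableSet
    (fun ζ _ => (hasFDerivAt_leftShear τ σ ζ).hasFDerivWithinAt) (leftShear_bijective τ σ).1.injOn
  simp only [det_leftShearDeriv, abs_one, ENNReal.ofReal_one, Measure.restrict_univ,
    withDensity_const, one_smul, Set.image_univ, (leftShear_bijective τ σ).2.range_eq] at h
  exact h

/-- **A right translation by `a_τ n_σ` multiplies `ds dt` by `e^{2τ}`**: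
`(rightAffine τ σ)_* volume = e^{2τ} • volume`. -/
theorem map_rightAffine_volume (τ σ : ℝ) :
    Measure.map (rightAffine τ σ) (volume : Measure ℂ) = ENNReal.ofReal (Real.exp (2 * τ)) • volume := by
  have h := map_withDensity_abs_det_fderiv_eq_addHaar (volume : Measure ℂ)
    MeasurableSet.univ.nullMeasurableSet
    (fun ζ _ => (hasFDerivAt_rightAffine τ σ ζ).hasFDerivWithinAt)
    (rightAffine_bijective τ σ).1.injOn
  simp only [det_rightAffineDeriv, abs_of_pos (Real.exp_pos _), Measure.restrict_univ,
    withDensity_const, Set.image_univ, (rightAffine_bijective τ σ).2.range_eq] at h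
  have hm : Measurable (rightAffine τ σ) := (hasFDerivAt_rightAffine τ σ · |>.continuousAt) |>
    fun hc => (continuous_iff_continuousAt.2 hc).measurable
  rw [Measure.map_smul] at h
  have hE : ENNReal.ofReal (Real.exp (2 * τ)) * ENNReal.ofReal (Real.exp (-(2 * τ))) = 1 := by
    rw [← ENNReal.ofReal_mul (Real.exp_pos _).le, ← Real.exp_add, add_neg_cancel, Real.exp_zero,
      ENNReal.ofReal_one]
  calc Measure.map (rightAffine τ σ) volume
      = (ENNReal.ofReal (Real.exp (2 * τ)) * ENNReal.ofReal (Real.exp (-(2 * τ)))) •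
          Measure.map (rightAffine τ σ) volume := by rw [hE, one_smul]
    _ = ENNReal.ofReal (Real.exp (2 * τ)) •
          (ENNReal.ofReal (Real.exp (-(2 * τ))) • Measure.map (rightAffine τ σ) volume) := by
          rw [smul_smul]
    _ = ENNReal.ofReal (Real.exp (2 * τ)) • volume := by rw [h]

/-! ### The left Haar measure of `B` and its modular function -/

/-- The chart as a map into the subgroup `B`. -/
noncomputable def borelCoordB (ζ : ℂ) : borelSubgroup := ⟨borelCoord ζ, borelCoord_mem ζ⟩

/-- The chart is continuous. -/
lemma continuous_borelCoord : Continuous borelCoord :=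
  (continuous_hyp.comp Complex.continuous_im).mul (continuous_unip.comp Complex.continuous_re)

/-- The chart into `B` is measurable. -/
lemma measurable_borelCoordB : Measurable borelCoordB :=
  (continuous_borelCoord.subtype_mk _).measurable

/-- `leftShear` is measurable. -/
lemma measurable_leftShear (τ σ : ℝ) : Measurable (leftShear τ σ) :=
  (continuous_iff_continuousAt.2 fun ζ => (hasFDerivAt_leftShear τ σ ζ).continuousAt).measurable

/-- `rightAffine` is measurable. -/
lemma measurable_rightAffine (τ σ : ℝ) : Measurable (rightAffine τ σ) :=
  (continuous_iff_continuousAt.2 fun ζ => (hasFDerivAt_rightAffine τ σ ζ).continuousAt).measurable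

/-- **The left Haar measure of `B`**: the Lebesgue measure `ds dt` of the chart transported to `B`. -/
noncomputable def borelHaar : Measure borelSubgroup := Measure.map borelCoordB volume

/-- Left translation by `b = a_τ n_σ` on `B` is the shear in the chart. -/
lemma mul_borelCoordB (τ σ : ℝ) (hb : hyp τ * unip σ ∈ borelSubgroup) (ζ : ℂ) :
    (⟨hyp τ * unip σ, hb⟩ : borelSubgroup) * borelCoordB ζ = borelCoordB (leftShear τ σ ζ) :=
  Subtype.ext (hyp_mul_unip_mul_borelCoord τ σ ζ)

/-- Right translation by `b = a_τ n_σ` on `B` is the affine map in the chart. -/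
lemma borelCoordB_mul (τ σ : ℝ) (hb : hyp τ * unip σ ∈ borelSubgroup) (ζ : ℂ) :
    borelCoordB ζ * (⟨hyp τ * unip σ, hb⟩ : borelSubgroup) = borelCoordB (rightAffine τ σ ζ) :=
  Subtype.ext (borelCoord_mul_hyp_mul_unip τ σ ζ)

/-- **`borelHaar` is left-invariant**: `(b ·)_* borelHaar = borelHaar` for every `b ∈ B`. -/
theorem map_mul_left_borelHaar (b : borelSubgroup) :
    Measure.map (fun x => b * x) borelHaar = borelHaar := by
  obtain ⟨g, hg⟩ := b
  obtain ⟨τ, σ, rfl⟩ := hg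
  unfold borelHaar
  rw [Measure.map_map (measurable_const_mul _) measurable_borelCoordB]
  have e : (fun x => (⟨hyp τ * unip σ, hyp_mul_unip_mem_borelSubgroup τ σ⟩ : borelSubgroup) * x) ∘
      borelCoordB = borelCoordB ∘ leftShear τ σ := by
    funext ζ
    exact mul_borelCoordB τ σ _ ζ
  rw [e, ← Measure.map_map measurable_borelCoordB (measurable_leftShear τ σ), map_leftShear_volume]

/-- **`borelHaar` is a left-invariant measure on `B`.** -/
theorem isMulLeftInvariant_borelHaar : IsMulLeftInvariant borelHaar :=
  ⟨map_mul_left_borelHaar⟩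

/-- **The modular function of `B`**: right translation by `b = a_τ n_σ` multiplies `borelHaar` by
`e^{2τ}`: `(· b)_* borelHaar = e^{2τ} • borelHaar`. -/
theorem map_mul_right_borelHaar (τ σ : ℝ) (hb : hyp τ * unip σ ∈ borelSubgroup) :
    Measure.map (fun x => x * (⟨hyp τ * unip σ, hb⟩ : borelSubgroup)) borelHaar =
      ENNReal.ofReal (Real.exp (2 * τ)) • borelHaar := by
  unfold borelHaar
  rw [Measure.map_map (measurable_mul_const _) measurable_borelCoordB]
  have e : (fun x => x * (⟨hyp τ * unip σ, hb⟩ : borelSubgroup)) ∘ borelCoordB =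
      borelCoordB ∘ rightAffine τ σ := by
    funext ζ
    exact borelCoordB_mul τ σ hb ζ
  rw [e, ← Measure.map_map measurable_borelCoordB (measurable_rightAffine τ σ),
    map_rightAffine_volume, Measure.map_smul]

/-- The chart into `B` is injective. -/
lemma borelCoordB_injective : Function.Injective borelCoordB :=
  fun _ _ h => borelCoord_injective (congrArg Subtype.val h)

/-- The chart into `B` is continuous. -/
lemma continuous_borelCoordB : Continuous borelCoordB := continuous_borelCoord.subtype_mk _

/-- The chart into `B` is a measurable embedding (continuous and injective on the Polish space `ℂ`). -/
lemma measurableEmbedding_borelCoordB : MeasurableEmbedding borelCoordB :=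
  continuous_borelCoordB.measurableEmbedding borelCoordB_injective

/-- The image of the unit disc of the chart has positive finite `borelHaar`-measure. -/
lemma borelHaar_image_ball :
    borelHaar (borelCoordB '' ball (0 : ℂ) 1) = volume (ball (0 : ℂ) 1) := by
  unfold borelHaar
  rw [measurableEmbedding_borelCoordB.map_apply, Set.preimage_image_eq _ borelCoordB_injective]

/-- **`B` is not unimodular**: `borelHaar` is not right-invariant (`a_1` scales it by `e²`). -/
theorem not_isMulRightInvariant_borelHaar : ¬ IsMulRightInvariant borelHaar := by
  intro h
  have h1 := map_mul_right_borelHaar 1 0 (hyp_mul_unip_mem_borelSubgroup 1 0)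
  rw [map_mul_right_eq_self] at h1
  have hμ := congrArg (fun μ : Measure borelSubgroup => μ (borelCoordB '' ball (0 : ℂ) 1)) h1
  simp only [Measure.smul_apply, smul_eq_mul, borelHaar_image_ball] at hμ
  have hpos : volume (ball (0 : ℂ) 1) ≠ 0 := (Metric.measure_ball_pos volume (0 : ℂ) one_pos).ne'
  have hfin : volume (ball (0 : ℂ) 1) ≠ ∞ := measure_ball_lt_top.ne
  have hE : ENNReal.ofReal (Real.exp (2 * 1)) = 1 := by
    have key : (1 : ℝ≥0∞) * volume (ball (0 : ℂ) 1) =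
        ENNReal.ofReal (Real.exp (2 * 1)) * volume (ball (0 : ℂ) 1) := by
      rw [one_mul]
      exact hμ
    exact ((ENNReal.mul_left_inj hpos hfin).1 key).symm
  rw [← ENNReal.ofReal_one, ENNReal.ofReal_eq_ofReal_iff (Real.exp_pos _).le zero_le_one] at hE
  have : Real.exp 0 < Real.exp (2 * 1) := Real.exp_lt_exp.2 (by norm_num)
  rw [Real.exp_zero] at this
  linarith

end Summit.Ventures.HodgeRepro2.T5SU11BorelHaar
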